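import Literature.NumberTheory.GaloisCohomology.Howard2004.DualityDatumLocalCupAnnihilatorLeftProofs
import Literature.NumberTheory.GaloisRepresentations.BrauerTower
import Literature.NumberTheory.GaloisCohomology.Howard2004.KolyvaginSystemReindex
import Literature.GroupTheory.FiniteAbelian.HomCounts
import Literature.NumberTheory.EllipticCurves.TowerSaturatedRepresentabilityProofs
import HarnessLib

/-!
# The scalar action under Howard's induced local pairing and its `ℤ/p^k`-reading: `A`-linearity of `∪`, the Frobenius
# property of the reading, and the onto adjoint (the level READINGS of the representability brick) — proofs

`Proofs` file (theorems only; no definition, no named fact, no instance, no `sorry`).  Companion of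
`DualityDatumLocalCupAnnihilator[Left]Proofs` (x9-p1-w4 / this seat).

The rank-free proof of the exactness clause (Exact) of Howard's H.4 for `F_𝔮` at `v ∣ p` (cell memo
`HOME/p1/H4-EXACT-AT-P-PLAN-x10b-p1-g8.md` §1(e)) represents balanced functionals on the saturated families by the dual
tower through x10b-p1-w2's `Tower.exists_mem_compatibleFamilies_forall_saturated_pairing_eq_functional`
(`TowerSaturatedRepresentabilityProofs`), whose LEVEL hypotheses for the pairings `B_k = ∪_k : H¹(K_v, T^{(k)}) × H¹(K_v, Tw T^{(k)})
→ Q_k = H²(K_v, R_k(1))`, the readings `λ_k : Q_k → ℤ/n_k` and the scalars `R_k` are: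
`hsurj` (the reading adjoint `y ↦ λ_k ∘ B_k(·, y)` is ONTO `Hom(X_k, ℤ/n_k)`), `hfrob` («`(∀ r, λ_k (r • q) = λ_k (r • q′)) → q = q′`»),
`hBlin` (`B_k (r • x) y = r • B_k x y`).  This file proves them for ONE duality datum `D` over a level ring `R` (the
Eisenstein instance `R = A_{m,k+1}` is mechanical), with the scalar action on `Hⁿ(K_v, ·)` spelled functorially
(`galoisCohomology.scalarMapH1`, `galoisCohomology.scalarMap … 2`; the `Module` structures `galoisCohomology.moduleH1` /
the assembler's `SMul` on `H²` unfold to these by `rfl`):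

* §1 `DualityDatum.isScalarLinear_twistOne` (`R(1)` is `R`-linear), **`localCup_scalarMapH1_left`**:
  `(r • x) ∪ y = H²(r •)(x ∪ y)` and `localCup_scalarMapH1_right` (= hBlin; `ContPairing.cupProduct_map`);
* §2 **`cohomologyMap_expLam_scalarMap_two`**: `H²(exp ∘ λ)(H²(r •) q) = H²(exp ∘ λ_r) q`, hence
  **`eq_of_forall_reading_scalarMap_two_eq`** (= hfrob: if the readings of `H²(r_i •) q` and `H²(r_i •) q′` through an
  injective `ι_v ∘ H²(exp ∘ λ)` agree for a DUALIZING family `(r_i)`, then `q = q′` — family detection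
  `eq_zero_of_forall_cohomologyMap_expLam_lamMul_eq_zero`);
* §3 **`exists_forall_reading_localCup_eq`** (= hsurj: every character `χ : H¹(K_v, T) → ℤ/p^k` is
  `x ↦ ι_v (H²(exp ∘ λ)(x ∪ y))` for some `y`, from the injectivity of both reading adjoints
  (`injective_localCupZMod[_flip]`) by counting, `FiniteAbelian.pairing_reading_surjective_of_injective`); `…_of_isPerfect` form.

Cell `pub/bsd-print-x9` (STUB A `hfin4` at `v ∣ p`, (Exact) brick (B6) inputs).  Conditional on the local invariant maps exactly
as the companion files.  BSD is not proved by any of this.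

References: [Howard2004HeegnerKolyvagin] §1.3 H.4 (arXiv:1202.6340 p. 7, L69–82), Def. 1.1.1; [MilneADT2006] Ch. I §0 Prop. 0.19,
Cor. 2.3; [NeukirchSchmidtWingberg2008] I §4 (1.4.2); [Hungerford1974] Ch. IV §4 Ex. 1; [SerreGaloisCohomology1997] I §2.2.
-/

set_option autoImplicit false

noncomputable section

open CategoryTheory Function NumberField IsDedekindDomain Field
open scoped ContRepresentation NumberField

namespace Literature.NumberTheory.GaloisCohomology.Howard2004

open Literature.NumberTheory.GaloisRepresentations
open Literature.NumberTheory.GaloisRepresentations.DiscreteGaloisModule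

variable {K : Type} [Field K] [NumberField K] {M : Type} [AddCommGroup M] [TopologicalSpace M]
  [DiscreteTopology M] {R : Type} [CommRing R] [Module R M] [TopologicalSpace R] [DiscreteTopology R]
  {p : ℕ} [Fact p.Prime] [Algebra ℤ_[p] R] {cd : ConjugationDatum K} {ρ : DiscreteGaloisModule K M}
  (D : DualityDatum p cd ρ R) {k : ℕ}
  (lam : R →+ ZMod (p ^ k))
  (hlam : ∀ (z : ℤ_[p]) (r : R), lam (algebraMap ℤ_[p] R z * r) = PadicInt.toZModPow k z * lam r)
  (exp : ZMod (p ^ k) →+ MuCarrier K (p ^ k))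
  (hexp : ∀ (g : absoluteGaloisGroup K) (x : ZMod (p ^ k)),
    exp (cyclotomicCharacterModPow K p k g * x) = mu K (p ^ k) g (exp x))

namespace DualityDatum

/-! ## §1 `R(1)` is `R`-linear; `(r • x) ∪ y = r • (x ∪ y) = x ∪ (r • y)` -/

/-- **`R(1)` is an `R`-linear Galois module**: `g · (r x) = r (g · x)` (`g` acts by the scalar `χ(g)`, `twistOne_apply`).
[cite: Howard2004HeegnerKolyvagin, §1.3 H.4 (arXiv p. 7, L69–73: R(1))] -/
theorem isScalarLinear_twistOne : D.twistOne.IsScalarLinear R := fun g r x ↦ by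
  rw [D.twistOne_apply, D.twistOne_apply, smul_eq_mul, smul_eq_mul, mul_left_comm]

omit [Algebra ℤ_[p] R] in
/-- **hBlin: `(r • x) ∪ y = H²(r •) (x ∪ y)`** in `H²(K_v, R(1))` — Howard's `e` is `R`-linear in the first variable and the cup
product is natural (`ContPairing.cupProduct_map` at `(r •, id, r •)`). [cite: Howard2004HeegnerKolyvagin, §1.3 H.4 (arXiv p. 7, L69–76) and Def. 1.1.1]
[cite: NeukirchSchmidtWingberg2008, I §4 (1.4.2)] -/
theorem localCup_scalarMapH1_left {p' : ℕ} [Fact p'.Prime] [Algebra ℤ_[p'] R] (D' : DualityDatum p' cd ρ R) (v : Place K)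
    (hρv : (ρ.toLocal v).IsScalarLinear R) (r : R)
    (x : galoisCohomology (ρ.toLocal v) 1) (y : galoisCohomology ((cd.twist ρ).toLocal v) 1) :
    D'.localCup v (galoisCohomology.scalarMapH1 (ρ.toLocal v) hρv r x) y =
      galoisCohomology.scalarMap (D'.twistOne.toLocal v) (isScalarLinear_toLocal D'.isScalarLinear_twistOne v) 2 r
        (D'.localCup v x y) := by
  haveI : CompactSpace (absoluteGaloisGroup (Place.Completion v)) := absoluteGaloisGroup_compactSpace _
  let α : (ρ.toLocal v).toTopRep ⟶ (ρ.toLocal v).toTopRep := TopRep.ofHom (scalarIntertwining (ρ.toLocal v) hρv r)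
  let β : ((cd.twist ρ).toLocal v).toTopRep ⟶ ((cd.twist ρ).toLocal v).toTopRep :=
    TopRep.ofHom ⟨⟨(AddMonoidHom.id M).toIntLinearMap, continuous_of_discreteTopology⟩,
      fun _ => ContinuousLinearMap.ext fun _ => rfl⟩
  let γ : (D'.twistOne.toLocal v).toTopRep ⟶ (D'.twistOne.toLocal v).toTopRep :=
    TopRep.ofHom (scalarIntertwining (D'.twistOne.toLocal v) (isScalarLinear_toLocal D'.isScalarLinear_twistOne v) r)
  have h := ContPairing.cupProduct_map (D'.ePairingLocal v) (D'.ePairingLocal v) α β γ (fun s t => by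
    change r • D'.e s t = D'.e (r • s) t
    rw [map_smul, LinearMap.smul_apply]) x y
  have hβ : cohomologyMap β 1 y = y := cohomologyMap_one_id_apply _ (AddMonoidHom.id M) (fun _ _ => rfl) (fun _ => rfl) y
  rw [hβ] at h
  exact h.symm

omit [Algebra ℤ_[p] R] in
/-- `x ∪ (r • y) = H²(r •) (x ∪ y)` (by `localCup_scalarMapH1_comm` and the left version).
[cite: Howard2004HeegnerKolyvagin, §1.3 H.4 (arXiv p. 7, L69–76)] [cite: NeukirchSchmidtWingberg2008, I §4 (1.4.2)] -/
theorem localCup_scalarMapH1_right {p' : ℕ} [Fact p'.Prime] [Algebra ℤ_[p'] R] (D' : DualityDatum p' cd ρ R) (v : Place K)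
    (hρv : (ρ.toLocal v).IsScalarLinear R) (hρv' : ((cd.twist ρ).toLocal v).IsScalarLinear R) (r : R)
    (x : galoisCohomology (ρ.toLocal v) 1) (y : galoisCohomology ((cd.twist ρ).toLocal v) 1) :
    D'.localCup v x (galoisCohomology.scalarMapH1 ((cd.twist ρ).toLocal v) hρv' r y) =
      galoisCohomology.scalarMap (D'.twistOne.toLocal v) (isScalarLinear_toLocal D'.isScalarLinear_twistOne v) 2 r
        (D'.localCup v x y) := by
  rw [← D'.localCup_scalarMapH1_comm v hρv hρv' r x y, D'.localCup_scalarMapH1_left v hρv r x y]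

/-! ## §2 hfrob: the readings of `H²(r_i •) q` through `ι_v ∘ H²(exp ∘ λ)` determine `q` -/

/-- **`H²(exp ∘ λ) (H²(r •) q) = H²(exp ∘ λ_r) q`** (`exp ∘ λ ∘ (r ·) = exp ∘ λ_r` on `R(1)`, functoriality of `H²`).
[cite: Howard2004HeegnerKolyvagin, §1.3 H.4 (arXiv p. 7, L78–82)] [cite: SerreGaloisCohomology1997, I §2.2] -/
theorem cohomologyMap_expLam_scalarMap_two (v : Place K) (r : R) (q : galoisCohomology (D.twistOne.toLocal v) 2) :
    cohomologyMap (D.expLamLocalHom lam hlam exp hexp v) 2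
        (galoisCohomology.scalarMap (D.twistOne.toLocal v) (isScalarLinear_toLocal D.isScalarLinear_twistOne v) 2 r q) =
      cohomologyMap (D.expLamLocalHom (lamMul lam r) (lamMul_semilinear lam hlam r) exp hexp v) 2 q := by
  let γ : (D.twistOne.toLocal v).toTopRep ⟶ (D.twistOne.toLocal v).toTopRep :=
    TopRep.ofHom (scalarIntertwining (D.twistOne.toLocal v) (isScalarLinear_toLocal D.isScalarLinear_twistOne v) r)
  have h := map_comp_apply_of (ContinuousMonoidHom.id _) (ContinuousMonoidHom.id _) (ContinuousMonoidHom.id _)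
    (fun _ => rfl) (resIdHom γ) (resIdHom (D.expLamLocalHom lam hlam exp hexp v))
    (resIdHom (D.expLamLocalHom (lamMul lam r) (lamMul_semilinear lam hlam r) exp hexp v)) (fun _ => rfl) 2 q
  exact h.symm

/-- **hfrob: the readings of `H²(r_i •) q` through `ι_v ∘ H²(exp ∘ λ)` determine `q`.**  With `ι_v : H²(K_v, μ_{p^k}) → ℤ/p^k`
injective and `(r_i)` a dualizing family of `R` for `(λ, exp)`: if `ι_v H²(exp λ)(H²(r_i •) q) = ι_v H²(exp λ)(H²(r_i •) q′)` for all `i`,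
then `q = q′` (the characters `exp ∘ λ_{r_i}` jointly detect `H²(K_v, R(1))`).
[cite: Howard2004HeegnerKolyvagin, §1.3 H.4 (arXiv p. 7, L78–82)] [cite: MilneADT2006, Ch. I Cor. 2.3] -/
theorem eq_of_forall_reading_scalarMap_two_eq (v : Place K)
    (ι₀ : galoisCohomology ((mu K (p ^ k)).toLocal v) 2 →+ ZMod (p ^ k)) (hι₀ : Injective ι₀)
    {ι : Type} [Finite ι] (r : ι → R) (hbij : Bijective fun x : R => fun i : ι => exp (lam (r i * x)))
    (q q' : galoisCohomology (D.twistOne.toLocal v) 2)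
    (h : ∀ i, ι₀ (cohomologyMap (D.expLamLocalHom lam hlam exp hexp v) 2
        (galoisCohomology.scalarMap (D.twistOne.toLocal v) (isScalarLinear_toLocal D.isScalarLinear_twistOne v) 2 (r i) q)) =
      ι₀ (cohomologyMap (D.expLamLocalHom lam hlam exp hexp v) 2
        (galoisCohomology.scalarMap (D.twistOne.toLocal v) (isScalarLinear_toLocal D.isScalarLinear_twistOne v) 2 (r i) q'))) :
    q = q' := by
  rw [← sub_eq_zero]
  refine D.eq_zero_of_forall_cohomologyMap_expLam_lamMul_eq_zero lam hlam exp hexp r hbij v (q - q') fun i ↦ ?_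
  have hi : cohomologyMap (D.expLamLocalHom (lamMul lam (r i)) (lamMul_semilinear lam hlam (r i)) exp hexp v) 2 q =
      cohomologyMap (D.expLamLocalHom (lamMul lam (r i)) (lamMul_semilinear lam hlam (r i)) exp hexp v) 2 q' := by
    rw [← D.cohomologyMap_expLam_scalarMap_two lam hlam exp hexp v (r i) q,
      ← D.cohomologyMap_expLam_scalarMap_two lam hlam exp hexp v (r i) q']
    exact hι₀ (h i)
  exact (map_sub _ q q').trans (sub_eq_zero.2 hi)

/-! ## §3 hsurj: the reading adjoint is onto `Hom(H¹(K_v, T), ℤ/p^k)` -/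

/-- **hsurj: every character `χ : H¹(K_v, T) → ℤ/p^k` is `x ↦ ι_v H²(exp ∘ λ)(x ∪ y)` for some `y ∈ H¹(K_v, Tw T)`** — at a finite
place, for `T` finite killed by `p^k`, `Θ` bijective and `ι_v` making both adjoints of the local Tate pairing injective: both reading
adjoints are injective (`injective_localCupZMod[_flip]`), so the adjoint is onto by counting
(`FiniteAbelian.pairing_reading_surjective_of_injective`). [cite: MilneADT2006, Ch. I §0 Prop. 0.19 and Cor. 2.3]
[cite: Hungerford1974, Ch. IV §4 Exercise 1] [cite: Howard2004HeegnerKolyvagin, §1.3 H.4 (arXiv p. 7, L78–82)] -/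
theorem exists_forall_reading_localCup_eq [Finite M] (hM : ∀ m : M, (p ^ k) • m = 0)
    (hΘ : Bijective (D.toTateDual lam hlam exp hexp)) (v : HeightOneSpectrum (𝓞 K))
    (ι₀ : galoisCohomology ((mu K (p ^ k)).toLocal (Sum.inr v : Place K)) 2 →+ ZMod (p ^ k))
    (hιL : Injective (localTatePairingZMod ρ (p ^ k) (Sum.inr v) ι₀))
    (hιR : Injective (localTatePairingZMod ρ (p ^ k) (Sum.inr v) ι₀).flip)
    (χ : galoisCohomology (ρ.toLocal (Sum.inr v)) 1 →+ ZMod (p ^ k)) :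
    ∃ y : galoisCohomology ((cd.twist ρ).toLocal (Sum.inr v)) 1, ∀ x : galoisCohomology (ρ.toLocal (Sum.inr v)) 1,
      ι₀ (cohomologyMap (D.expLamLocalHom lam hlam exp hexp (Sum.inr v)) 2 (D.localCup (Sum.inr v) x y)) = χ x := by
  haveI : NeZero (p ^ k) := ⟨pow_ne_zero k (Fact.out : p.Prime).ne_zero⟩
  haveI := finite_galoisCohomology_one_toLocal ρ v
  haveI := finite_galoisCohomology_one_toLocal (cd.twist ρ) v
  have hsurj := Literature.GroupTheory.FiniteAbelian.pairing_reading_surjective_of_injective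
    (fun x ↦ galoisCohomology.nsmul_eq_zero_of_forall _ hM x)
    (fun y ↦ galoisCohomology.nsmul_eq_zero_of_forall _ hM y)
    ((localTatePairingZMod ρ (p ^ k) (Sum.inr v) ι₀).compl₂
      (galoisCohomology.map (Literature.NumberTheory.EllipticCurves.DiscreteGaloisModule.localMap
        (D.toTateDual lam hlam exp hexp) (Sum.inr v)) 1))
    (AddMonoidHom.id _)
    (fun y hy ↦ ?_)
    (fun x hx ↦ ?_) χ
  · obtain ⟨y, hy⟩ := hsurj
    exact ⟨y, fun x ↦ by rw [← hy x, AddMonoidHom.id_apply, D.localCupZMod_apply lam hlam exp hexp]⟩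
  · exact (injective_iff_map_eq_zero _).1 (D.injective_localCupZMod_flip lam hlam exp hexp hΘ _ ι₀ hιR) y
      (AddMonoidHom.ext fun x' ↦ hy x')
  · exact (injective_iff_map_eq_zero _).1 (D.injective_localCupZMod lam hlam exp hexp hΘ _ ι₀ hιL) x
      (AddMonoidHom.ext fun y' ↦ hx y')

end DualityDatum

end Literature.NumberTheory.GaloisCohomology.Howard2004

end
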